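import Summits.CriticalPhenomena.PercolationContinuityZ3.Theorems.PercNearOneGluingNoHeavyLowerTailSahiTripartitionULC
import Mathlib
import HarnessLib
import HarnessLib.Audit.Tags

/-!
# `NoHeavyLowerTail` (crux stmt-CriticalPhenomena-4575), master-family line P1 (gen 19):
# pattern counts of ordered tripartitions — cell-exchange symmetry, the `nParts` dictionary, and
# THEOREM "at least one of the two ULC inequalities holds"; the surviving HALF B as a typed conjecture

Support file (seat `prim-masterthm-p1`, gen 19; `--supports stmt-CriticalPhenomena-4575`), on top of `…SahiTripartitionULC` (gen 17: `triCount`,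
`nParts`, the degree-1 theorem `triCount_and_mul_le`).  Memo `run/shared/lean/prim/prim-masterthm/FROM-prim-masterthm-p1-g19-ULC-REFUTATION.md` §4.

CONTEXT.  Gen 19 refuted the tripartition ULC lemma-candidate (`not_unateTripartitionULC`: on 9 points `3n₁n₃ > n₂²`, i.e. HALF A fails;
HALF B `3n₀n₂ ≤ n₁²` holds for that witness).  This file supplies the bookkeeping that turns gen 17's pattern counts into statements about
`nParts`, and proves that the two halves can never fail together.
* `triSum` (a pattern-weighted sum over ordered tripartitions; `triCount` is the case of an indicator weight), its additivity, and the two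
  CELL-EXCHANGE SYMMETRIES `triSum_swap12` (first two cells; the disjoint-pair double sum is symmetric) and `triSum_swap23` (second and third
  cells; `y ↦ xᶜ \ y` is an involution of `2^{xᶜ}`); hence the exact-pattern counts `patCount u (a,b,c)` depend only on the number of `true`s.
* DICTIONARY: `nParts u 0 = A₀`, `nParts u 1 = 3A₁`, `nParts u 2 = 3A₂`, `nParts u 3 = A₃` and `#{X,Y ∈ u} = A₂ + A₃`, `#{X ∈ u} = #{Y ∈ u} =
  A₁ + 2A₂ + A₃`, `#all = A₀ + 3A₁ + 3A₂ + A₃`, where `A_k = patCount u` of the pattern with the first `k` cells in `u`.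
* **THEOREM `halfA_or_halfB`**: for every monotone `u`, `3·n₀·n₂ ≤ n₁²  ∨  3·n₁·n₃ ≤ n₂²`.  Proof: the degree-1 inequality (negative correlation
  of two cells, tree) reads `(A₂+A₃)(A₀+3A₁+3A₂+A₃) ≤ (A₁+2A₂+A₃)²`, i.e. `A₀A₂ + A₁A₃ + A₀A₃ ≤ A₁² + A₂² + A₁A₂`; if both `A₁² < A₀A₂` and
  `A₂² < A₁A₃` then also `A₁A₂ < A₀A₃`, contradiction.  (Probabilistically: the unconditional covariance is the mixture of the two conditional
  covariances — given `Z ∈ u` (Half A) and given `Z ∉ u` (Half B) — plus a nonnegative between-group term, so NA forces one of them to be `≤ 0`.)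
* **CONJECTURE `PureTripartitionHalfB` (typed; the surviving half)**: for every MONOTONE `u` (pure model, no twist), `3·n₀·n₂ ≤ n₁²` — given that
  the third cell is NOT in `u`, the events "first cell ∈ u", "second cell ∈ u" are negatively correlated; equivalently the face-moments
  `d_k = P(k given cells ∉ u)` satisfy `d₂² ≥ d₁d₃`.  Census: all monotone functions on ≤ 6 points (gen 17/18, exact), calibrated annealing
  through 10 points (gen 19; the Half-A killers satisfy it with margin), Kahn–Neiman (thresholds), read-once.  The all-twist ("unate") version is
  NOT conjectured: by the cube-complement duality it is equivalent to Half A in all twists, refuted.  Why the Half-A mechanism does not transfer: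
  a member of an up-set can be a transversal (its complement contains no member), a face of a complex cannot be isolated in this way (`∅` is a
  face of every window, and a large face makes the complex dense in every window) — memo §4.
HONEST FRAMING: bookkeeping + one proved disjunction + one typed conjecture; Half B is OPEN. [this work]
-/

namespace Summit.CriticalPhenomena.PercolationContinuityZ3.Theorems

namespace SahiTripartition

open Finset

variable {ι : Type*} [Fintype ι] [DecidableEq ι]

/-! ### 1. Pattern-weighted sums over ordered tripartitions and the two cell-exchange symmetries -/

/-- `triSum u g` = `Σ` over ordered tripartitions `(X, Y, Z = Xᶜ \ Y)` of the weight `g (u X) (u Y) (u Z)`. [this work] -/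
def triSum (u : Finset ι → Bool) (g : Bool → Bool → Bool → ℕ) : ℕ :=
  ∑ x : Finset ι, ∑ y ∈ xᶜ.powerset, g (u x) (u y) (u (xᶜ \ y))

/-- `triCount` is the `triSum` of an indicator weight. [this work] -/
theorem triCount_eq_triSum (u : Finset ι → Bool) (P : Bool → Bool → Bool → Bool) :
    triCount u P = triSum u (fun a b c => if P a b c = true then 1 else 0) := by
  unfold triCount triSum
  refine sum_congr rfl fun x _ => ?_
  rw [card_filter]

/-- Additivity of `triSum` in the weight. [this work] -/
theorem triSum_add (u : Finset ι → Bool) (g h : Bool → Bool → Bool → ℕ) :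
    triSum u (fun a b c => g a b c + h a b c) = triSum u g + triSum u h := by
  unfold triSum
  rw [← sum_add_distrib]
  refine sum_congr rfl fun x _ => ?_
  rw [← sum_add_distrib]

/-- **Symmetry 2 ↔ 3**: exchanging the second and third cells (`y ↦ xᶜ \ y` is an involution of `2^{xᶜ}`). [this work] -/
theorem triSum_swap23 (u : Finset ι → Bool) (g : Bool → Bool → Bool → ℕ) :
    triSum u (fun a b c => g a c b) = triSum u g := by
  unfold triSum
  refine sum_congr rfl fun x _ => ?_
  refine sum_nbij' (fun y => xᶜ \ y) (fun y => xᶜ \ y) (fun y _ => mem_powerset.mpr sdiff_subset)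
    (fun y _ => mem_powerset.mpr sdiff_subset) (fun y hy => Finset.sdiff_sdiff_eq_self (mem_powerset.mp hy))
    (fun y hy => Finset.sdiff_sdiff_eq_self (mem_powerset.mp hy)) (fun y hy => ?_)
  rw [Finset.sdiff_sdiff_eq_self (mem_powerset.mp hy)]

/-- The disjoint-pair form of `triSum`: a double sum over all pairs with a disjointness indicator. [this work] -/
theorem triSum_eq_sum_univ (u : Finset ι → Bool) (g : Bool → Bool → Bool → ℕ) :
    triSum u g = ∑ x : Finset ι, ∑ y : Finset ι, if Disjoint x y then g (u x) (u y) (u (x ∪ y)ᶜ) else 0 := by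
  unfold triSum
  refine sum_congr rfl fun x _ => ?_
  have hset : (univ : Finset (Finset ι)).filter (fun y => Disjoint x y) = xᶜ.powerset := by
    ext y; simp [mem_powerset, subset_compl_iff_disjoint_left]
  rw [← sum_filter, hset]
  refine sum_congr rfl fun y _ => ?_
  rw [compl_union, sdiff_eq_inter_compl]

/-- **Symmetry 1 ↔ 2**: exchanging the first two cells (the disjoint-pair double sum is symmetric). [this work] -/
theorem triSum_swap12 (u : Finset ι → Bool) (g : Bool → Bool → Bool → ℕ) :
    triSum u (fun a b c => g b a c) = triSum u g := by
  rw [triSum_eq_sum_univ, triSum_eq_sum_univ, sum_comm]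
  refine sum_congr rfl fun x _ => sum_congr rfl fun y _ => ?_
  have e1 : Disjoint y x = Disjoint x y := propext disjoint_comm
  simp only [e1, union_comm y x]

/-! ### 2. Exact-pattern counts and the `nParts` dictionary -/

/-- Number of ordered tripartitions with the exact membership pattern `p = (u X, u Y, u Z)`. [this work] -/
def patCount (u : Finset ι → Bool) (p : Bool × Bool × Bool) : ℕ :=
  triSum u (fun a b c => if (a, b, c) = p then 1 else 0)

/-- Pattern counts are symmetric in the first two cells. [this work] -/
theorem patCount_swap12 (u : Finset ι → Bool) (a b c : Bool) : patCount u (b, a, c) = patCount u (a, b, c) := by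
  unfold patCount
  rw [← triSum_swap12 u (fun x y z => if (x, y, z) = (a, b, c) then 1 else 0)]
  congr 1; funext x y z
  simp only [Prod.mk.injEq]
  exact if_congr ⟨fun h => ⟨h.2.1, h.1, h.2.2⟩, fun h => ⟨h.2.1, h.1, h.2.2⟩⟩ rfl rfl

/-- Pattern counts are symmetric in the last two cells. [this work] -/
theorem patCount_swap23 (u : Finset ι → Bool) (a b c : Bool) : patCount u (a, c, b) = patCount u (a, b, c) := by
  unfold patCount
  rw [← triSum_swap23 u (fun x y z => if (x, y, z) = (a, b, c) then 1 else 0)]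
  congr 1; funext x y z
  simp only [Prod.mk.injEq]
  exact if_congr ⟨fun h => ⟨h.1, h.2.2, h.2.1⟩, fun h => ⟨h.1, h.2.2, h.2.1⟩⟩ rfl rfl

/-- The four symmetry classes of patterns: `classCount u k` = number of ordered tripartitions with exactly the FIRST `k` cells in `u`
(for `k ≥ 3`: all three). [this work] -/
def classCount (u : Finset ι → Bool) : ℕ → ℕ
  | 0 => patCount u (false, false, false)
  | 1 => patCount u (true, false, false)
  | 2 => patCount u (true, true, false)
  | _ => patCount u (true, true, true)

/-- `(f,t,f)` is in class 1. [this work] -/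
theorem patCount_ftf (u : Finset ι → Bool) : patCount u (false, true, false) = classCount u 1 :=
  patCount_swap12 u true false false

/-- `(f,f,t)` is in class 1. [this work] -/
theorem patCount_fft (u : Finset ι → Bool) : patCount u (false, false, true) = classCount u 1 := by
  rw [patCount_swap23 u false true false]; exact patCount_ftf u

/-- `(t,f,t)` is in class 2. [this work] -/
theorem patCount_tft (u : Finset ι → Bool) : patCount u (true, false, true) = classCount u 2 :=
  patCount_swap23 u true true false

/-- `(f,t,t)` is in class 2. [this work] -/
theorem patCount_ftt (u : Finset ι → Bool) : patCount u (false, true, true) = classCount u 2 := by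
  rw [patCount_swap12 u true false true]; exact patCount_tft u

/-- DICTIONARY: `n₀ = A₀`. [this work] -/
theorem nParts_zero_eq (u : Finset ι → Bool) : nParts u 0 = classCount u 0 := by
  show nParts u 0 = patCount u (false, false, false)
  unfold nParts patCount; rw [triCount_eq_triSum]
  congr 1; funext a b c; cases a <;> cases b <;> cases c <;> rfl

/-- DICTIONARY: `n₁ = 3A₁`. [this work] -/
theorem nParts_one_eq (u : Finset ι → Bool) : nParts u 1 = 3 * classCount u 1 := by
  have e : 3 * classCount u 1 =
      patCount u (true, false, false) + patCount u (false, true, false) + patCount u (false, false, true) := by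
    rw [patCount_ftf, patCount_fft]; simp only [classCount]; ring
  rw [e]; unfold nParts patCount; rw [triCount_eq_triSum, ← triSum_add, ← triSum_add]
  congr 1; funext a b c; cases a <;> cases b <;> cases c <;> rfl

/-- DICTIONARY: `n₂ = 3A₂`. [this work] -/
theorem nParts_two_eq (u : Finset ι → Bool) : nParts u 2 = 3 * classCount u 2 := by
  have e : 3 * classCount u 2 =
      patCount u (true, true, false) + patCount u (true, false, true) + patCount u (false, true, true) := by
    rw [patCount_tft, patCount_ftt]; simp only [classCount]; ring
  rw [e]; unfold nParts patCount; rw [triCount_eq_triSum, ← triSum_add, ← triSum_add]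
  congr 1; funext a b c; cases a <;> cases b <;> cases c <;> rfl

/-- DICTIONARY: `n₃ = A₃`. [this work] -/
theorem nParts_three_eq (u : Finset ι → Bool) : nParts u 3 = classCount u 3 := by
  show nParts u 3 = patCount u (true, true, true)
  unfold nParts patCount; rw [triCount_eq_triSum]
  congr 1; funext a b c; cases a <;> cases b <;> cases c <;> rfl

/-- DICTIONARY: `#{X,Y ∈ u} = A₂ + A₃`. [this work] -/
theorem triCount_and_eq_classCount (u : Finset ι → Bool) :
    triCount u (fun a b _ => a && b) = classCount u 2 + classCount u 3 := by
  show _ = patCount u (true, true, false) + patCount u (true, true, true)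
  unfold patCount; rw [triCount_eq_triSum, ← triSum_add]
  congr 1; funext a b c; cases a <;> cases b <;> cases c <;> rfl

/-- DICTIONARY: `#{X ∈ u} = A₁ + 2A₂ + A₃`. [this work] -/
theorem triCount_fst_eq_classCount (u : Finset ι → Bool) :
    triCount u (fun a _ _ => a) = classCount u 1 + 2 * classCount u 2 + classCount u 3 := by
  have e : classCount u 1 + 2 * classCount u 2 + classCount u 3 = patCount u (true, false, false) +
      patCount u (true, true, false) + patCount u (true, false, true) + patCount u (true, true, true) := by
    rw [patCount_tft]; simp only [classCount]; ring
  rw [e]; unfold patCount; rw [triCount_eq_triSum, ← triSum_add, ← triSum_add, ← triSum_add]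
  congr 1; funext a b c; cases a <;> cases b <;> cases c <;> rfl

/-- DICTIONARY: `#{Y ∈ u} = A₁ + 2A₂ + A₃`. [this work] -/
theorem triCount_snd_eq_classCount (u : Finset ι → Bool) :
    triCount u (fun _ b _ => b) = classCount u 1 + 2 * classCount u 2 + classCount u 3 := by
  have e : classCount u 1 + 2 * classCount u 2 + classCount u 3 = patCount u (false, true, false) +
      patCount u (true, true, false) + patCount u (false, true, true) + patCount u (true, true, true) := by
    rw [patCount_ftf, patCount_ftt]; simp only [classCount]; ring
  rw [e]; unfold patCount; rw [triCount_eq_triSum, ← triSum_add, ← triSum_add, ← triSum_add]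
  congr 1; funext a b c; cases a <;> cases b <;> cases c <;> rfl

/-- DICTIONARY: `#all = A₀ + 3A₁ + 3A₂ + A₃`. [this work] -/
theorem triCount_true_eq_classCount (u : Finset ι → Bool) :
    triCount u (fun _ _ _ => true) = classCount u 0 + 3 * classCount u 1 + 3 * classCount u 2 + classCount u 3 := by
  have e : classCount u 0 + 3 * classCount u 1 + 3 * classCount u 2 + classCount u 3 =
      patCount u (false, false, false) + patCount u (true, false, false) + patCount u (false, true, false) +
        patCount u (false, false, true) + patCount u (true, true, false) + patCount u (true, false, true) +
        patCount u (false, true, true) + patCount u (true, true, true) := by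
    rw [patCount_ftf, patCount_fft, patCount_tft, patCount_ftt]; simp only [classCount]; ring
  rw [e]; unfold patCount
  rw [triCount_eq_triSum, ← triSum_add, ← triSum_add, ← triSum_add, ← triSum_add, ← triSum_add, ← triSum_add, ← triSum_add]
  congr 1; funext a b c; cases a <;> cases b <;> cases c <;> rfl

/-! ### 3. At least one of the two ULC inequalities always holds -/

/-- The degree-1 inequality of the tree (`triCount_and_mul_le`) in the pattern classes:
`(A₂+A₃)(A₀+3A₁+3A₂+A₃) ≤ (A₁+2A₂+A₃)²`. [this work] -/
theorem na_classCount (u : Finset ι → Bool) (hu : Monotone u) :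
    (classCount u 2 + classCount u 3) * (classCount u 0 + 3 * classCount u 1 + 3 * classCount u 2 + classCount u 3) ≤
      (classCount u 1 + 2 * classCount u 2 + classCount u 3) * (classCount u 1 + 2 * classCount u 2 + classCount u 3) := by
  have h := triCount_and_mul_le u hu
  rwa [triCount_and_eq_classCount, triCount_true_eq_classCount, triCount_fst_eq_classCount,
    triCount_snd_eq_classCount] at h

/-- **THEOREM (the two halves never fail together).**  For every monotone `u` on a finite set, the cell counts of a uniform random
ordered tripartition satisfy `3·n₀·n₂ ≤ n₁²` (Half B) OR `3·n₁·n₃ ≤ n₂²` (Half A).  (Half A alone can fail: `not_unateTripartitionULC`.)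
[this work] -/
theorem halfA_or_halfB (u : Finset ι → Bool) (hu : Monotone u) :
    3 * nParts u 0 * nParts u 2 ≤ nParts u 1 ^ 2 ∨ 3 * nParts u 1 * nParts u 3 ≤ nParts u 2 ^ 2 := by
  rw [nParts_zero_eq, nParts_one_eq, nParts_two_eq, nParts_three_eq]
  have hna := na_classCount u hu
  set A0 := classCount u 0
  set A1 := classCount u 1
  set A2 := classCount u 2
  set A3 := classCount u 3
  rcases Nat.lt_or_ge ((3 * A1) ^ 2) (3 * A0 * (3 * A2)) with h1 | hB
  swap; · exact Or.inl hB
  rcases Nat.lt_or_ge ((3 * A2) ^ 2) (3 * (3 * A1) * A3) with h2 | hA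
  swap; · exact Or.inr hA
  exfalso
  have h1' : A1 * A1 < A0 * A2 := by nlinarith [h1]
  have h2' : A2 * A2 < A1 * A3 := by nlinarith [h2]
  have h3 : A1 * A1 * (A2 * A2) < A0 * A2 * (A1 * A3) := Nat.mul_lt_mul'' h1' h2'
  nlinarith [hna, h1', h2', h3, Nat.zero_le (A0 * A3), Nat.zero_le (A1 * A2)]

/-! ### 4. The surviving half, typed -/

/-- **CONJECTURE (pure Half B; typed).**  For every finite set and every MONOTONE Boolean property `u` of its subsets (no twist), the cell
counts of a uniform random ordered tripartition satisfy `3·n₀·n₂ ≤ n₁²`: given that the third cell is NOT in `u`, "first cell ∈ u" and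
"second cell ∈ u" are negatively correlated; equivalently the face-moments `d_k = P(k given cells ∉ u)` are log-concave at `k = 2`.
The other half (`3n₁n₃ ≤ n₂²`) is FALSE (`not_unateTripartitionULC`, 9 points) and, by `halfA_or_halfB`, whenever it fails Half B holds.
Census in the file header; OPEN. [this work] [status: open] -/
@[conjecture] def PureTripartitionHalfB : Prop :=
  ∀ (n : ℕ) (u : Finset (Fin n) → Bool), Monotone u → 3 * nParts u 0 * nParts u 2 ≤ nParts u 1 ^ 2

/-- Kernel link: the (refuted, stronger) unate lemma-candidate would have implied pure Half B (its `t = ∅` instance, first conjunct).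
[this work] -/
theorem pureTripartitionHalfB_of_unate (h : UnateTripartitionULC) : PureTripartitionHalfB := by
  intro n u hu
  have hmono : Monotone (fun x => u (symmDiff x ∅)) := by
    intro x y hxy
    show u (symmDiff x ∅) ≤ u (symmDiff y ∅)
    rw [show (∅ : Finset (Fin n)) = ⊥ from rfl, symmDiff_bot, symmDiff_bot]
    exact hu hxy
  exact (h n u ∅ hmono).1

/-- Where Half A fails (as for the 9-point witness `cexU9` of `…SahiTripartitionULCRefutation`), Half B holds. [this work] -/
theorem halfB_of_not_halfA (u : Finset ι → Bool) (hu : Monotone u) (h : ¬ 3 * nParts u 1 * nParts u 3 ≤ nParts u 2 ^ 2) :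
    3 * nParts u 0 * nParts u 2 ≤ nParts u 1 ^ 2 :=
  (halfA_or_halfB u hu).resolve_right h

end SahiTripartition

end Summit.CriticalPhenomena.PercolationContinuityZ3.Theorems
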